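import Summits.Ventures.LatticeQCDFlow.Exactness.IMHColdStartPathMixture
import HarnessLib

/-!
# The cold start is invisible to shift-invariant statistics: from a mode, every shift-invariant event of the
# flow-MCMC run has exactly its equilibrium probability

HONEST FRAMING: exact (Metropolis-corrected) sampling algorithms for lattice gauge theory;
figures of merit are autocorrelation/cost numbers at stated couplings and volumes; no
continuum-physics claim.

Venture `LatticeQCDFlow` (cell pub-lqcd), topic `Exactness`; FANOUT row 30 (lean-1, GEN-33).  NEW WORK of the
cell, general state space.  `K = indepMH q w`, `x₀` a mode of the normalised weight `w`, `r = 1 − 1/w(x₀) < 1`, `P_μ` the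
chain law on path space, `θ_b x = x(b + ·)`.  The path mixture law (`IMHColdStartPathMixture`:
`P_{x₀} ∘ θ_b⁻¹ = (1 − r^b)·P_π + r^b·P_{x₀}`) applied to a set of runs `E` with `θ_b⁻¹E = E` for some `b ≥ 1` reads
`P_{x₀}(E) = (1 − r^b)P_π(E) + r^b P_{x₀}(E)`, and `1 − r^b > 0` cancels:

* **`imh_chain_shiftInvariant_real_mode`** / **`imh_chain_shiftInvariant_mode`** — for every measurable set of runs `E`
  invariant under some shift `θ_b`, `b ≥ 1`: `P_{x₀}(E) = P_π(E)` EXACTLY (tail events of period `b` included);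
* **`imh_chain_shiftInvariant_integral_mode`** — for every bounded measurable statistic `F` with `F ∘ θ_b = F`:
  `E_{x₀}[F] = E_π[F]`;
* **`imh_chain_shiftInvariant_ae_mode`** — in particular every shift-invariant almost-sure property of the equilibrium
  run (convergence of time averages, of windowed autocovariance and `τ_int` estimators, of empirical quantiles …)
  holds almost surely from the cold start, and conversely — with EQUAL exceptional probabilities, not just both zero.

Relation to the tree: `Exactness/IMHErgodicEveryStart.trajMeasure_dirac_eq_one_indepMH` transfers FULL-measure
shift-invariant events to EVERY start via harmonic functions; here, at the mode, ALL shift-invariant (and `θ_b`-periodic)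
events transfer with their exact probability, by one line from the mixture law.  NOT CLAIMED: non-modal starts;
events that are only asymptotically invariant.

No `sorry`, no new definitions, nothing cited as a fact; general measurable space with measurable singletons.
-/

noncomputable section

namespace Summit.Ventures.LatticeQCDFlow.Exactness

open MeasureTheory ProbabilityTheory Function Finset
open scoped ENNReal
open Summit.Ventures.LatticeQCDFlow.Scoring

variable {Ω : Type*} [MeasurableSpace Ω] [MeasurableSingletonClass Ω]
variable {q : Measure Ω} [IsProbabilityMeasure q] {w : Ω → ℝ}

omit [MeasurableSingletonClass Ω] in
/-- **EVERY `θ_b`-INVARIANT EVENT HAS ITS EQUILIBRIUM PROBABILITY FROM THE MODE** (real-valued form): `w` measurable (a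
`Fact`), positive, normalised, maximal at `x₀`; `E` a measurable set of runs with `θ_b⁻¹ E = E` for some `b ≥ 1`.  Then
`P_{x₀}(E) = P_π(E)`. [ours] -/
theorem imh_chain_shiftInvariant_real_mode [Fact (Measurable w)] (hw0 : ∀ y, 0 < w y) {x₀ : Ω}
    (hmax : ∀ y, w y ≤ w x₀) [IsProbabilityMeasure (q.withDensity fun y => ENNReal.ofReal (w y))]
    {E : Set (ℕ → Ω)} (hE : MeasurableSet E) {b : ℕ} (hb : b ≠ 0)
    (hinv : (fun (x : ℕ → Ω) (n : ℕ) => x (b + n)) ⁻¹' E = E) :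
    (Kernel.trajMeasure (X := fun _ : ℕ => Ω) (Measure.dirac x₀)
        (fun n : ℕ => (indepMH q w).comap (fun h : (i : ↥(Finset.Iic n)) → Ω => h ⟨n, Finset.mem_Iic.2 le_rfl⟩)
          (measurable_pi_apply _))).real E =
      (Kernel.trajMeasure (X := fun _ : ℕ => Ω) (q.withDensity fun y => ENNReal.ofReal (w y))
        (fun n : ℕ => (indepMH q w).comap (fun h : (i : ↥(Finset.Iic n)) → Ω => h ⟨n, Finset.mem_Iic.2 le_rfl⟩)
          (measurable_pi_apply _))).real E := by
  have hA0 : 0 < (w x₀)⁻¹ := inv_pos.mpr (hw0 x₀)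
  have hW : 1 ≤ w x₀ := one_le_of_mode (q := q) hmax
  have hr0 : 0 ≤ 1 - (w x₀)⁻¹ := sub_nonneg.2 (inv_le_one_of_one_le₀ hW)
  have hr1 : 1 - (w x₀)⁻¹ < 1 := sub_lt_self _ hA0
  have hrb : (1 - (w x₀)⁻¹) ^ b < 1 := pow_lt_one₀ hr0 hr1 hb
  have h := imh_chain_shift_real_mode (q := q) hw0 hmax hE b (x₀ := x₀)
  rw [hinv] at h
  -- `P₀(E) = (1 − r^b)·P_π(E) + r^b·P₀(E)` with `r^b < 1`
  have hkey : (1 - (1 - (w x₀)⁻¹) ^ b) *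
      ((Kernel.trajMeasure (X := fun _ : ℕ => Ω) (Measure.dirac x₀)
        (fun n : ℕ => (indepMH q w).comap (fun h : (i : ↥(Finset.Iic n)) → Ω => h ⟨n, Finset.mem_Iic.2 le_rfl⟩)
          (measurable_pi_apply _))).real E -
      (Kernel.trajMeasure (X := fun _ : ℕ => Ω) (q.withDensity fun y => ENNReal.ofReal (w y))
        (fun n : ℕ => (indepMH q w).comap (fun h : (i : ↥(Finset.Iic n)) → Ω => h ⟨n, Finset.mem_Iic.2 le_rfl⟩)
          (measurable_pi_apply _))).real E) = 0 := by
    linarith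
  rcases mul_eq_zero.1 hkey with h1 | h2
  · exact absurd h1 (by linarith)
  · linarith

omit [MeasurableSingletonClass Ω] in
/-- **Measure form**: `P_{x₀}(E) = P_π(E)` in `[0, ∞]` for every measurable `θ_b`-invariant set of runs, `b ≥ 1`. [ours] -/
theorem imh_chain_shiftInvariant_mode [Fact (Measurable w)] (hw0 : ∀ y, 0 < w y) {x₀ : Ω}
    (hmax : ∀ y, w y ≤ w x₀) [IsProbabilityMeasure (q.withDensity fun y => ENNReal.ofReal (w y))]
    {E : Set (ℕ → Ω)} (hE : MeasurableSet E) {b : ℕ} (hb : b ≠ 0)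
    (hinv : (fun (x : ℕ → Ω) (n : ℕ) => x (b + n)) ⁻¹' E = E) :
    Kernel.trajMeasure (X := fun _ : ℕ => Ω) (Measure.dirac x₀)
        (fun n : ℕ => (indepMH q w).comap (fun h : (i : ↥(Finset.Iic n)) → Ω => h ⟨n, Finset.mem_Iic.2 le_rfl⟩)
          (measurable_pi_apply _)) E =
      Kernel.trajMeasure (X := fun _ : ℕ => Ω) (q.withDensity fun y => ENNReal.ofReal (w y))
        (fun n : ℕ => (indepMH q w).comap (fun h : (i : ↥(Finset.Iic n)) → Ω => h ⟨n, Finset.mem_Iic.2 le_rfl⟩)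
          (measurable_pi_apply _)) E := by
  have h := imh_chain_shiftInvariant_real_mode (q := q) hw0 hmax hE hb hinv (x₀ := x₀)
  exact (measureReal_eq_measureReal_iff (measure_ne_top _ _) (measure_ne_top _ _)).1 h

omit [MeasurableSingletonClass Ω] in
/-- **EVERY `θ_b`-INVARIANT BOUNDED STATISTIC HAS ITS EQUILIBRIUM EXPECTATION FROM THE MODE**: `F` bounded measurable
with `F(x(b + ·)) = F(x)` for all runs `x`, some `b ≥ 1` ⇒ `E_{x₀}[F] = E_π[F]`. [ours] -/
theorem imh_chain_shiftInvariant_integral_mode [Fact (Measurable w)] (hw0 : ∀ y, 0 < w y) {x₀ : Ω}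
    (hmax : ∀ y, w y ≤ w x₀) [IsProbabilityMeasure (q.withDensity fun y => ENNReal.ofReal (w y))]
    {F : (ℕ → Ω) → ℝ} (hF : Measurable F) {C : ℝ} (hC : ∀ x, |F x| ≤ C) {b : ℕ} (hb : b ≠ 0)
    (hinv : ∀ x : ℕ → Ω, F (fun n => x (b + n)) = F x) :
    ∫ x, F x ∂(Kernel.trajMeasure (X := fun _ : ℕ => Ω) (Measure.dirac x₀)
        (fun n : ℕ => (indepMH q w).comap (fun h : (i : ↥(Finset.Iic n)) → Ω => h ⟨n, Finset.mem_Iic.2 le_rfl⟩)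
          (measurable_pi_apply _))) =
      ∫ x, F x ∂(Kernel.trajMeasure (X := fun _ : ℕ => Ω) (q.withDensity fun y => ENNReal.ofReal (w y))
        (fun n : ℕ => (indepMH q w).comap (fun h : (i : ↥(Finset.Iic n)) → Ω => h ⟨n, Finset.mem_Iic.2 le_rfl⟩)
          (measurable_pi_apply _))) := by
  have hA0 : 0 < (w x₀)⁻¹ := inv_pos.mpr (hw0 x₀)
  have hW : 1 ≤ w x₀ := one_le_of_mode (q := q) hmax
  have hr0 : 0 ≤ 1 - (w x₀)⁻¹ := sub_nonneg.2 (inv_le_one_of_one_le₀ hW)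
  have hr1 : 1 - (w x₀)⁻¹ < 1 := sub_lt_self _ hA0
  have hrb : (1 - (w x₀)⁻¹) ^ b < 1 := pow_lt_one₀ hr0 hr1 hb
  have h := imh_chain_shift_integral_mode_sub_stationary (q := q) hw0 hmax hF hC b (x₀ := x₀)
  simp_rw [hinv] at h
  have hkey : (1 - (1 - (w x₀)⁻¹) ^ b) *
      (∫ x, F x ∂(Kernel.trajMeasure (X := fun _ : ℕ => Ω) (Measure.dirac x₀)
        (fun n : ℕ => (indepMH q w).comap (fun h : (i : ↥(Finset.Iic n)) → Ω => h ⟨n, Finset.mem_Iic.2 le_rfl⟩)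
          (measurable_pi_apply _))) -
      ∫ x, F x ∂(Kernel.trajMeasure (X := fun _ : ℕ => Ω) (q.withDensity fun y => ENNReal.ofReal (w y))
        (fun n : ℕ => (indepMH q w).comap (fun h : (i : ↥(Finset.Iic n)) → Ω => h ⟨n, Finset.mem_Iic.2 le_rfl⟩)
          (measurable_pi_apply _)))) = 0 := by
    linarith
  rcases mul_eq_zero.1 hkey with h1 | h2
  · exact absurd h1 (by linarith)
  · linarith

omit [MeasurableSingletonClass Ω] in
/-- **SHIFT-INVARIANT ALMOST-SURE PROPERTIES TRANSFER BOTH WAYS, WITH EQUAL EXCEPTIONAL PROBABILITIES**: for a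
measurable `θ_b`-invariant set of runs `E` (`b ≥ 1`), `P_{x₀}(Eᶜ) = P_π(Eᶜ)`; in particular `P_π(E) = 1 ↔ P_{x₀}(E) = 1`.
[ours] -/
theorem imh_chain_shiftInvariant_ae_mode [Fact (Measurable w)] (hw0 : ∀ y, 0 < w y) {x₀ : Ω}
    (hmax : ∀ y, w y ≤ w x₀) [IsProbabilityMeasure (q.withDensity fun y => ENNReal.ofReal (w y))]
    {E : Set (ℕ → Ω)} (hE : MeasurableSet E) {b : ℕ} (hb : b ≠ 0)
    (hinv : (fun (x : ℕ → Ω) (n : ℕ) => x (b + n)) ⁻¹' E = E) :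
    Kernel.trajMeasure (X := fun _ : ℕ => Ω) (Measure.dirac x₀)
        (fun n : ℕ => (indepMH q w).comap (fun h : (i : ↥(Finset.Iic n)) → Ω => h ⟨n, Finset.mem_Iic.2 le_rfl⟩)
          (measurable_pi_apply _)) Eᶜ =
      Kernel.trajMeasure (X := fun _ : ℕ => Ω) (q.withDensity fun y => ENNReal.ofReal (w y))
        (fun n : ℕ => (indepMH q w).comap (fun h : (i : ↥(Finset.Iic n)) → Ω => h ⟨n, Finset.mem_Iic.2 le_rfl⟩)
          (measurable_pi_apply _)) Eᶜ ∧
    (Kernel.trajMeasure (X := fun _ : ℕ => Ω) (q.withDensity fun y => ENNReal.ofReal (w y))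
        (fun n : ℕ => (indepMH q w).comap (fun h : (i : ↥(Finset.Iic n)) → Ω => h ⟨n, Finset.mem_Iic.2 le_rfl⟩)
          (measurable_pi_apply _)) E = 1 ↔
      Kernel.trajMeasure (X := fun _ : ℕ => Ω) (Measure.dirac x₀)
        (fun n : ℕ => (indepMH q w).comap (fun h : (i : ↥(Finset.Iic n)) → Ω => h ⟨n, Finset.mem_Iic.2 le_rfl⟩)
          (measurable_pi_apply _)) E = 1) := by
  have hinvc : (fun (x : ℕ → Ω) (n : ℕ) => x (b + n)) ⁻¹' Eᶜ = Eᶜ := by rw [Set.preimage_compl, hinv]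
  refine ⟨imh_chain_shiftInvariant_mode hw0 hmax hE.compl hb hinvc, ?_⟩
  rw [imh_chain_shiftInvariant_mode hw0 hmax hE hb hinv]

end Summit.Ventures.LatticeQCDFlow.Exactness
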